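import Literature.NumberTheory.Transcendental.ChudnovskyAnalytic
import Literature.NumberTheory.Transcendental.ChudnovskyHeights
import Literature.NumberTheory.EllipticCurves.ComplexTorus
import HarnessLib

/-!
# Schneider's theorem on the periods of `℘` — the analytic half (auxiliary function, Schwarz lemma)

Topic `Literature/NumberTheory/Transcendental` (trunk T-TRANSCEND), family `periods`. First of the
proof files discharging the named fact `Literature.NumberTheory.Transcendental.schneider`
(`KontsevichZagier.lean`, **periods.S31**; Th. Schneider, *Arithmetische Untersuchungen
elliptischer Integrale*, Math. Ann. 113 (1937) 1–13): *if the invariants `g₂, g₃` of a lattice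
`Λ` are algebraic, every non-zero period `l ∈ Λ` is transcendental.*

We follow the proof printed in Baker 1975, Ch. 6: Theorem 6.1 (the Schneider–Lang criterion,
§§3–5, pp. 57–59) applied as in the proof of Theorem 6.5 (p. 56) to the three functions
`f₁ = ℘`, `f₂ = ℘'`, `f₃ = z`, whose ring `K[z, ℘, ℘']` is closed under `d/dz`
(`℘'' = 6℘² - g₂/2`), at the points `z = (r + ½) l` (`r = 0, 1, 2, …`), where
`℘ = ℘(l/2) =: e` (a root of `4x³ - g₂x - g₃`), `℘' = 0` and `z ∈ ℚ(l)`. If `l` were algebraic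
these infinitely many points would contradict Theorem 6.1. Only the half-period `w = l/2` with
`w ∉ Λ` is needed (every non-zero period is `2^k` times such an `l`), so no change of basis of
the lattice occurs.

This file is the analytic part (Baker 1975, Ch. 6, §4 Lemma 3 and §5), in the concrete form
already used for Chudnovsky's theorem in `ChudnovskyAnalytic.lean` (whose `σ`-function bounds we
reuse): for a coefficient family `p` of bidegree `≤ (D, D)`,

* the points `pt l n = l/2 + n l` and their values `℘ = e`, `℘' = 0` (`weierstrassP_pt`,
  `derivWeierstrassP_pt`, `e_cubic`);
* the auxiliary function `F_p(z) = ∑ p (i,j) zⁱ ℘(z)ʲ` (`F`) and the ENTIRE function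
  `G_p = ∑ p (i,j) zⁱ (σ²℘)ʲ σ^{2(D-j)} = σ^{2D} F_p` (`G`, `G_eq`; Baker's `φ = (h₁h₂h₃)^L Φ`),
  with the order-two growth bound `‖G_p(z)‖ ≤ ‖p‖ exp(C (D+1)(1+|z|²))` (`norm_G_le`);
* `norm_G_le_of_zeros` — Schwarz's lemma: if `F_p^{(j)}(pt l n) = 0` for `j < S`, `n < m`, then
  `‖G_p(w)‖ ≤ ‖p‖ e^{C(D+1)(1+R²)} (4ρ/R)^{S m}` for `|w| ≤ ρ`, `R ≥ 2ρ`, `ρ ≥ ρ₀(m)`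
  (`Baker1975.Analytic.norm_le_of_analyticOrderAt`);
* `norm_iteratedDeriv_F_le_of_zeros` — division by `σ^{2D}` on small circles around the points
  and Cauchy's inequality: `‖F_p^{(k)}(pt l ν)‖ ≤ ‖p‖ k! e^{C((D+1)(1+R²)+k)} (4ρ/R)^{S m}`;
* `eq_zero_of_F_eq_zero` — `z` and `℘` are algebraically independent: if `F_p ≡ 0` off `Λ` then
  `p = 0` (`℘` is onto `ℂ`, `PeriodPair.exists_weierstrassP_eq`, and a polynomial with
  infinitely many roots vanishes); hence `analyticOrderAt_F_ne_top`.

The arithmetic half (Siegel's lemma, the formal values, Liouville's inequality) and the endgame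
are in the sibling files `SchneiderPeriodsValues.lean`, `SchneiderPeriodsProofs.lean`.

## References

* [Baker1975] A. Baker, *Transcendental Number Theory*, CUP 1975, Ch. 6 §§1–5, pp. 55–59
  (Thm 6.1 = Schneider–Lang; Thm 6.5 and p. 55: "Schneider showed that if `g₂, g₃` are
  algebraic then any period of `℘(z)` is transcendental").
* [Schneider1937] Th. Schneider, *Arithmetische Untersuchungen elliptischer Integrale*,
  Math. Ann. 113 (1937), 1–13.
-/

noncomputable section

open Complex Metric Filter Set Finset
open _root_.Topology
open scoped PeriodPair

namespace Literature.NumberTheory.Transcendental.Schneider1937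

open Literature.NumberTheory.Transcendental.Chudnovsky (Sp sigma_sq_mul_weierstrassP
  differentiable_Sp exists_bound_Sg_Sp_sigma one_add_le_exp_one_add_sq coeff_sum_monomial_fin
  add_notMem norm_apply_le)

variable (L : PeriodPair) (l : ℂ)

/-! ### The points `l/2 + n l` and the value `e = ℘(l/2)` -/

/-- The points `pt l n = l/2 + n·l = (2n+1) l/2` (`n = 0, 1, 2, …`) at which the auxiliary
function is made to vanish (Baker 1975, p. 56: "`z = (r + ½)ω`"). [cite: Baker1975, Ch. 6 §2 Thm 6.5 p. 56] -/
def pt (n : ℕ) : ℂ := l / 2 + n * l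

/-- `e = ℘(l/2)`. [folklore] -/
def e : ℂ := ℘[L] (l / 2)

/-- `pt l n = (2n+1) · (l/2)`. [folklore] -/
lemma pt_eq (n : ℕ) : pt l n = (2 * n + 1) * (l / 2) := by
  unfold pt; ring

variable {L l}

/-- `n l ∈ Λ`. [folklore] -/
lemma nat_mul_mem (hl : l ∈ L.lattice) (n : ℕ) : (n : ℂ) * l ∈ L.lattice := by
  simpa using L.lattice.smul_mem (n : ℤ) hl

/-- `pt l n ∉ Λ` when `l ∈ Λ`, `l/2 ∉ Λ`. [folklore] -/
theorem pt_notMem (hl : l ∈ L.lattice) (hl2 : l / 2 ∉ L.lattice) (n : ℕ) : pt l n ∉ L.lattice :=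
  add_notMem L hl2 (nat_mul_mem hl n)

/-- `℘(pt l n) = e`. [folklore] -/
theorem weierstrassP_pt (hl : l ∈ L.lattice) (n : ℕ) : ℘[L] (pt l n) = e L l := by
  unfold pt e
  simpa using L.weierstrassP_add_coe (l / 2) ⟨n * l, nat_mul_mem hl n⟩

/-- `℘'(l/2) = 0` (`℘'` is odd and `Λ`-periodic). [folklore] -/
theorem derivWeierstrassP_half (hl : l ∈ L.lattice) : ℘'[L] (l / 2) = 0 := by
  have := L.derivWeierstrassP_sub_coe (l / 2) ⟨l, hl⟩
  rw [Subtype.coe_mk, show l / 2 - l = -(l / 2) by ring, L.derivWeierstrassP_neg] at this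
  have h2 : (2 : ℂ) * ℘'[L] (l / 2) = 0 := by linear_combination -this
  simpa using h2

/-- `℘'(pt l n) = 0`. [folklore] -/
theorem derivWeierstrassP_pt (hl : l ∈ L.lattice) (n : ℕ) : ℘'[L] (pt l n) = 0 := by
  unfold pt
  have h := L.derivWeierstrassP_add_coe (l / 2) ⟨n * l, nat_mul_mem hl n⟩
  simp only at h
  rw [h, derivWeierstrassP_half hl]

/-- `4e³ - g₂ e - g₃ = 0`: `e` is algebraic over `ℚ(g₂, g₃)`. [folklore] -/
theorem e_cubic (hl : l ∈ L.lattice) (hl2 : l / 2 ∉ L.lattice) :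
    4 * e L l ^ 3 - L.g₂ * e L l - L.g₃ = 0 := by
  have h := L.derivWeierstrassP_sq (l / 2) hl2
  rw [derivWeierstrassP_half hl] at h
  unfold e
  linear_combination -h

/-- The points `pt l n` are pairwise distinct (`l ≠ 0`). [folklore] -/
theorem pt_injective (hl0 : l ≠ 0) : Function.Injective (pt l) := by
  intro a b h
  unfold pt at h
  have : (a : ℂ) * l = (b : ℂ) * l := by linear_combination h
  exact_mod_cast mul_right_cancel₀ hl0 this

/-- `‖pt l n‖ ≤ (n + 1) ‖l‖`. [folklore] -/
lemma norm_pt_le (n : ℕ) : ‖pt l n‖ ≤ ((n : ℝ) + 1) * ‖l‖ := by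
  rw [pt_eq, norm_mul, norm_div, Complex.norm_two]
  have : ‖(2 * (n : ℂ) + 1)‖ ≤ 2 * n + 2 := by
    calc ‖(2 * (n : ℂ) + 1)‖ ≤ ‖(2 * (n : ℂ))‖ + ‖(1 : ℂ)‖ := norm_add_le _ _
      _ = 2 * n + 1 := by simp
      _ ≤ 2 * n + 2 := by linarith
  calc ‖(2 * (n : ℂ) + 1)‖ * (‖l‖ / 2) ≤ (2 * n + 2) * (‖l‖ / 2) := by gcongr
    _ = ((n : ℝ) + 1) * ‖l‖ := by ring

variable (L l)

/-! ### The auxiliary function `F_p` and the entire function `G_p = σ^{2D} F_p` -/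

/-- The auxiliary function `F_p(z) = ∑_{i,j ≤ D} p (i,j) zⁱ ℘(z)ʲ` of a coefficient family `p`
of bidegree `≤ (D, D)` (Baker's `Φ = ∑ p(λ₁,λ₂) f₁^{λ₁} f₂^{λ₂}` with `f₁ = z`, `f₂ = ℘`).
[cite: Baker1975, Ch. 6 §4 Lemma 2 p. 58] -/
def F (D : ℕ) (p : Fin (D + 1) × Fin (D + 1) → ℂ) (z : ℂ) : ℂ :=
  ∑ ij, p ij * (z ^ (ij.1 : ℕ) * ℘[L] z ^ (ij.2 : ℕ))

/-- The entire function `G_p = ∑ p (i,j) zⁱ (σ²℘)ʲ σ^{2(D-j)}`, equal to `σ^{2D} F_p` off the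
lattice (Baker's `φ = (h₁ ⋯ hₙ)^L Φ`). [cite: Baker1975, Ch. 6 §4 Lemma 3 p. 58] -/
def G (D : ℕ) (p : Fin (D + 1) × Fin (D + 1) → ℂ) (z : ℂ) : ℂ :=
  ∑ ij, p ij * (z ^ (ij.1 : ℕ) * Sp L z ^ (ij.2 : ℕ) * L.weierstrassSigma z ^ (2 * (D - ij.2)))

variable {L l} {D : ℕ}

/-- `F_p` is analytic at every non-lattice point. [folklore] -/
theorem analyticAt_F (p : Fin (D + 1) × Fin (D + 1) → ℂ) {z : ℂ} (hz : z ∉ L.lattice) :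
    AnalyticAt ℂ (F L D p) z := by
  have h1 := L.analyticOnNhd_weierstrassP z hz
  unfold F
  refine Finset.analyticAt_fun_sum _ fun ij _ => ?_
  exact analyticAt_const.mul ((analyticAt_id.pow _).mul (h1.pow _))

/-- `F_p` is analytic on `Λᶜ`. [folklore] -/
theorem analyticOnNhd_F (p : Fin (D + 1) × Fin (D + 1) → ℂ) :
    AnalyticOnNhd ℂ (F L D p) (L.lattice : Set ℂ)ᶜ := fun _ hz => analyticAt_F p hz

/-- `G_p = σ^{2D} F_p` off the lattice. [folklore] -/
theorem G_eq {z : ℂ} (hz : z ∉ L.lattice) (p : Fin (D + 1) × Fin (D + 1) → ℂ) :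
    G L D p z = L.weierstrassSigma z ^ (2 * D) * F L D p z := by
  unfold G F
  rw [Finset.mul_sum]
  refine Finset.sum_congr rfl fun ij _ => ?_
  rw [← sigma_sq_mul_weierstrassP L hz]
  have h2 : (ij.2 : ℕ) ≤ D := Nat.lt_succ_iff.mp ij.2.isLt
  have hD : 2 * D = 2 * (D - ij.2) + 2 * ij.2 := by omega
  conv_rhs => rw [hD]
  ring

/-- `G_p` and `σ^{2D} F_p` agree near every non-lattice point. [folklore] -/
theorem G_eventuallyEq {z : ℂ} (hz : z ∉ L.lattice) (p : Fin (D + 1) × Fin (D + 1) → ℂ) :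
    G L D p =ᶠ[𝓝 z] (fun w => L.weierstrassSigma w ^ (2 * D)) * F L D p := by
  filter_upwards [L.isClosed_lattice.isOpen_compl.mem_nhds hz] with w hw
  exact G_eq hw p

/-- `G_p` is entire. [folklore] -/
theorem differentiable_G (p : Fin (D + 1) × Fin (D + 1) → ℂ) : Differentiable ℂ (G L D p) := by
  have hσ : Differentiable ℂ L.weierstrassSigma := L.differentiable_weierstrassSigma_holds
  have h2 := differentiable_Sp L
  unfold G
  fun_prop

variable (L) in
/-- **Growth of `G_p`** (Baker 1975, Ch. 6, Lemma 3: "`|φ(z)| < exp{c₁₁(k log k + L R^ρ)}`"):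
`‖G_p(z)‖ ≤ ‖p‖ exp(C (D+1)(1+|z|²))` with `C` depending only on the lattice.
[cite: Baker1975, Ch. 6 §4 Lemma 3 p. 58] -/
theorem norm_G_le :
    ∃ C : ℝ, 0 ≤ C ∧ ∀ (D : ℕ) (p : Fin (D + 1) × Fin (D + 1) → ℂ) (z : ℂ),
      ‖G L D p z‖ ≤ ‖p‖ * Real.exp (C * (D + 1) * (1 + ‖z‖ ^ 2)) := by
  obtain ⟨C, hC, h⟩ := exists_bound_Sg_Sp_sigma L
  refine ⟨3 * C + 5, by positivity, fun D p z => ?_⟩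
  obtain ⟨-, h2, h3⟩ := h z
  set t : ℝ := 1 + ‖z‖ ^ 2 with ht
  have ht1 : 1 ≤ t := by nlinarith [norm_nonneg z]
  set E : ℝ := Real.exp ((C + 1) * t) with hE
  have hE1 : 1 ≤ E := Real.one_le_exp (by positivity)
  have hzE : ‖z‖ ≤ E := by
    refine (le_trans (by linarith [norm_nonneg z]) (one_add_le_exp_one_add_sq ‖z‖)).trans ?_
    exact Real.exp_le_exp.mpr (by nlinarith)
  have hSpE : ‖Sp L z‖ ≤ E := h2.trans (Real.exp_le_exp.mpr (by nlinarith))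
  have hσE : ‖L.weierstrassSigma z‖ ≤ E := h3.trans (Real.exp_le_exp.mpr (by nlinarith))
  -- each term is bounded by `‖p‖ E^{3D}`
  have hterm : ∀ ij : Fin (D + 1) × Fin (D + 1),
      ‖p ij * (z ^ (ij.1 : ℕ) * Sp L z ^ (ij.2 : ℕ) *
        L.weierstrassSigma z ^ (2 * (D - ij.2)))‖ ≤ ‖p‖ * E ^ (3 * D) := by
    intro ij
    have hl1 : (ij.1 : ℕ) ≤ D := Nat.lt_succ_iff.mp ij.1.isLt
    have hl2 : (ij.2 : ℕ) ≤ D := Nat.lt_succ_iff.mp ij.2.isLt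
    rw [norm_mul, norm_mul, norm_mul, norm_pow, norm_pow, norm_pow]
    have hpow : ‖z‖ ^ (ij.1 : ℕ) * ‖Sp L z‖ ^ (ij.2 : ℕ) *
        ‖L.weierstrassSigma z‖ ^ (2 * (D - ij.2)) ≤ E ^ (3 * D) := by
      calc _ ≤ E ^ (ij.1 : ℕ) * E ^ (ij.2 : ℕ) * E ^ (2 * (D - ij.2)) := by gcongr
        _ = E ^ ((ij.1 : ℕ) + ij.2 + 2 * (D - ij.2)) := by rw [pow_add, pow_add]
        _ ≤ E ^ (3 * D) := pow_le_pow_right₀ hE1 (by omega)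
    exact mul_le_mul (norm_apply_le p ij) hpow (by positivity) (norm_nonneg _)
  have hcard : (Finset.univ : Finset (Fin (D + 1) × Fin (D + 1))).card = (D + 1) ^ 2 := by
    simp [sq]
  have hD1 : ((D + 1 : ℕ) : ℝ) ^ 2 ≤ Real.exp (2 * (D + 1) * t) := by
    have h0 : ((D + 1 : ℕ) : ℝ) ≤ Real.exp ((D + 1 : ℕ) * t) := by
      calc ((D + 1 : ℕ) : ℝ) ≤ (D + 1 : ℕ) * t := le_mul_of_one_le_right (by positivity) ht1
        _ ≤ (D + 1 : ℕ) * t + 1 := by linarith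
        _ ≤ Real.exp ((D + 1 : ℕ) * t) := Real.add_one_le_exp _
    calc ((D + 1 : ℕ) : ℝ) ^ 2 ≤ Real.exp ((D + 1 : ℕ) * t) ^ 2 := by gcongr
      _ = Real.exp (2 * (D + 1) * t) := by rw [sq, ← Real.exp_add]; push_cast; ring_nf
  calc ‖G L D p z‖ ≤ ∑ ij, ‖p ij * (z ^ (ij.1 : ℕ) * Sp L z ^ (ij.2 : ℕ) *
        L.weierstrassSigma z ^ (2 * (D - ij.2)))‖ := norm_sum_le _ _
    _ ≤ ∑ _ij : Fin (D + 1) × Fin (D + 1), ‖p‖ * E ^ (3 * D) :=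
        Finset.sum_le_sum fun ij _ => hterm ij
    _ = (D + 1 : ℕ) ^ 2 * (‖p‖ * E ^ (3 * D)) := by
        rw [Finset.sum_const, hcard, nsmul_eq_mul]; push_cast; ring
    _ ≤ Real.exp (2 * (D + 1) * t) * (‖p‖ * E ^ (3 * D)) := by gcongr
    _ = ‖p‖ * (Real.exp (2 * (D + 1) * t) * E ^ (3 * D)) := by ring
    _ ≤ ‖p‖ * Real.exp ((3 * C + 5) * (D + 1) * t) := by
        gcongr
        rw [hE, ← Real.exp_nat_mul, ← Real.exp_add]
        apply Real.exp_le_exp.mpr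
        push_cast
        nlinarith


/-! ### Zeros of high order at the points `pt l n` and Schwarz's lemma -/

/-- `l ≠ 0` if `l/2 ∉ Λ`. [folklore] -/
lemma ne_zero_of_half_notMem (hl2 : l / 2 ∉ L.lattice) : l ≠ 0 := by
  rintro rfl
  exact hl2 (by simp)

/-- If `F_p^{(j)}(pt l n) = 0` for `j < S` then the entire function `G_p = σ^{2D} F_p` vanishes
to order `≥ S` at `pt l n`. [folklore] -/
theorem le_analyticOrderAt_G (hl : l ∈ L.lattice) (hl2 : l / 2 ∉ L.lattice)
    (p : Fin (D + 1) × Fin (D + 1) → ℂ) {S n : ℕ}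
    (h : ∀ j < S, iteratedDeriv j (F L D p) (pt l n) = 0) :
    (S : ℕ∞) ≤ analyticOrderAt (G L D p) (pt l n) := by
  have hc : pt l n ∉ L.lattice := pt_notMem hl hl2 n
  have h2 : (S : ℕ∞) ≤ analyticOrderAt (F L D p) (pt l n) :=
    (natCast_le_analyticOrderAt_iff_iteratedDeriv_eq_zero (analyticAt_F p hc)).mpr h
  have hσ : AnalyticAt ℂ (fun w => L.weierstrassSigma w ^ (2 * D)) (pt l n) :=
    ((show Differentiable ℂ L.weierstrassSigma from
      L.differentiable_weierstrassSigma_holds).analyticAt _).pow _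
  rw [analyticOrderAt_congr (G_eventuallyEq hc p), analyticOrderAt_mul hσ (analyticAt_F p hc)]
  exact le_add_left h2

variable (l) in
/-- The points `pt l n`, `n < m`, as a finite set. [folklore] -/
def pts (m : ℕ) : Finset ℂ := (Finset.range m).image (pt l)

/-- `#pts = m` (`l ≠ 0`). [folklore] -/
lemma card_pts (hl0 : l ≠ 0) (m : ℕ) : (pts l m).card = m := by
  unfold pts
  rw [Finset.card_image_of_injective _ (pt_injective hl0), Finset.card_range]

/-- Membership in `pts`. [folklore] -/
lemma mem_pts {m : ℕ} {x : ℂ} (hx : x ∈ pts l m) : ∃ n, n < m ∧ x = pt l n := by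
  unfold pts at hx
  simp only [Finset.mem_image, Finset.mem_range] at hx
  obtain ⟨n, hn, rfl⟩ := hx
  exact ⟨n, hn, rfl⟩

variable (l) in
/-- `ρ₀ m = (m+1)‖l‖ + 1`: the unit discs around the points `pt l n`, `n < m`, lie in the disc
`|z| ≤ ρ₀ m`. [folklore] -/
def ρ₀ (m : ℕ) : ℝ := ((m : ℝ) + 1) * ‖l‖ + 1

/-- `1 ≤ ρ₀ m`. [folklore] -/
lemma one_le_ρ₀ (m : ℕ) : 1 ≤ ρ₀ l m := by
  unfold ρ₀; nlinarith [norm_nonneg l, (Nat.cast_nonneg m : (0 : ℝ) ≤ m)]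

/-- `‖pt l n + u‖ ≤ ρ₀ m` for `n < m`, `‖u‖ ≤ 1`. [folklore] -/
lemma norm_pt_add_le {m n : ℕ} (hn : n < m) {u : ℂ} (hu : ‖u‖ ≤ 1) :
    ‖pt l n + u‖ ≤ ρ₀ l m := by
  have h1 := norm_pt_le (l := l) n
  have hn' : (n : ℝ) + 1 ≤ (m : ℝ) + 1 := by
    have : (n : ℝ) ≤ m := by exact_mod_cast hn.le
    linarith
  calc ‖pt l n + u‖ ≤ ‖pt l n‖ + ‖u‖ := norm_add_le _ _
    _ ≤ ((n : ℝ) + 1) * ‖l‖ + 1 := add_le_add h1 hu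
    _ ≤ ((m : ℝ) + 1) * ‖l‖ + 1 := by gcongr
    _ = ρ₀ l m := rfl

variable (L) in
/-- **Schwarz's lemma for `G_p`** (Baker 1975, Ch. 6, §5: the integral over the circle
`|z| = R` against `F(z)^j = ∏ (z - y_i)^j`). If `F_p^{(j)}(pt l n) = 0` for all `j < S`,
`n < m`, then for `ρ ≥ ρ₀ m`, `R ≥ 2ρ` and `|w| ≤ ρ`,
`‖G_p(w)‖ ≤ ‖p‖ exp(C (D+1)(1+R²)) (4ρ/R)^{S m}`: `G_p` has `m` zeros of order `≥ S` in the disc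
`|z| ≤ ρ` and is compared with its maximum on `|z| = R`. [cite: Baker1975, Ch. 6 §5 p. 59] -/
theorem norm_G_le_of_zeros (hl : l ∈ L.lattice) (hl2 : l / 2 ∉ L.lattice) :
    ∃ C : ℝ, 0 ≤ C ∧ ∀ (D S m : ℕ) (p : Fin (D + 1) × Fin (D + 1) → ℂ),
      (∀ n < m, ∀ j < S, iteratedDeriv j (F L D p) (pt l n) = 0) →
      ∀ ρ : ℝ, ρ₀ l m ≤ ρ → ∀ R : ℝ, 2 * ρ ≤ R → ∀ w : ℂ, ‖w‖ ≤ ρ →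
        ‖G L D p w‖ ≤ ‖p‖ * Real.exp (C * (D + 1) * (1 + R ^ 2)) * (4 * ρ / R) ^ (S * m) := by
  obtain ⟨C, hC, hG⟩ := norm_G_le L
  refine ⟨C, hC, fun D S m p hF ρ hρ R hR w hw => ?_⟩
  have hl0 : l ≠ 0 := ne_zero_of_half_notMem hl2
  have hρ1 : 1 ≤ ρ := (one_le_ρ₀ m).trans hρ
  have hρ0 : 0 < ρ := by linarith
  have hR0 : 0 < R := by linarith
  set S' := pts l m with hS'
  have hcard : S'.card = m := card_pts hl0 m
  -- norms of the zeros
  have hcS : ∀ x ∈ S', ‖x‖ ≤ ρ := by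
    intro x hx
    obtain ⟨n, hn, rfl⟩ := mem_pts hx
    have := norm_pt_add_le (l := l) hn (u := 0) (by simp)
    rw [add_zero] at this
    exact this.trans hρ
  -- orders of vanishing
  have hord : ∀ x ∈ S', (S : ℕ∞) ≤ analyticOrderAt (G L D p) x := by
    intro x hx
    obtain ⟨n, hn, rfl⟩ := mem_pts hx
    exact le_analyticOrderAt_G hl hl2 p (hF n hn)
  -- the bound on the circle `|z| = R`
  set θ : ℝ := ‖p‖ * Real.exp (C * (D + 1) * (1 + R ^ 2)) with hθ
  have hθb : ∀ z ∈ sphere (0 : ℂ) R, ‖G L D p z‖ ≤ θ := by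
    intro z hz
    rw [mem_sphere_zero_iff_norm] at hz
    have := hG D p z
    rwa [hz] at this
  -- lower bound for `∏ (z - c)^S` on the circle, upper bound at `w`
  have hmF : ∀ z ∈ sphere (0 : ℂ) R, (R - ρ) ^ (S * S'.card) ≤ ‖∏ x ∈ S', (z - x) ^ S‖ := by
    intro z hz
    rw [mem_sphere_zero_iff_norm] at hz
    refine Baker1975.Analytic.le_norm_prod_pow S' S (by linarith) fun x hx => ?_
    calc R - ρ ≤ ‖z‖ - ‖x‖ := by rw [hz]; linarith [hcS x hx]
      _ ≤ ‖z - x‖ := norm_sub_norm_le z x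
  have hwF : ‖∏ x ∈ S', (w - x) ^ S‖ ≤ (2 * ρ) ^ (S * S'.card) :=
    Baker1975.Analytic.norm_prod_pow_le S' S fun x hx =>
      calc ‖w - x‖ ≤ ‖w‖ + ‖x‖ := norm_sub_le w x
        _ ≤ 2 * ρ := by linarith [hcS x hx]
  have hm0 : (0 : ℝ) < (R - ρ) ^ (S * S'.card) := pow_pos (by linarith) _
  have key := Baker1975.Analytic.norm_le_of_analyticOrderAt (differentiable_G p) S' S hord
    hR0 hθb hm0 hmF (w := w) (by linarith)
  have hθ0 : 0 ≤ θ := by positivity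
  calc ‖G L D p w‖ ≤ θ / (R - ρ) ^ (S * S'.card) * ‖∏ x ∈ S', (w - x) ^ S‖ := key
    _ ≤ θ / (R - ρ) ^ (S * S'.card) * (2 * ρ) ^ (S * S'.card) := by gcongr
    _ = θ * ((2 * ρ) / (R - ρ)) ^ (S * m) := by
        rw [hcard, div_pow]; field_simp
    _ ≤ θ * (4 * ρ / R) ^ (S * m) := by
        refine mul_le_mul_of_nonneg_left
          (pow_le_pow_left₀ (div_nonneg (by linarith) (by linarith)) ?_ _) hθ0
        rw [div_le_div_iff₀ (by linarith) hR0]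
        nlinarith

/-! ### Division by `σ^{2D}` and Cauchy's inequality -/

/-- Off the lattice, `‖F_p(z)‖ = ‖G_p(z)‖ / ‖σ(z)‖^{2D}`. [folklore] -/
theorem norm_F_eq {z : ℂ} (hz : z ∉ L.lattice) (p : Fin (D + 1) × Fin (D + 1) → ℂ) :
    ‖F L D p z‖ = ‖G L D p z‖ / ‖L.weierstrassSigma z‖ ^ (2 * D) := by
  have hσ := L.weierstrassSigma_ne_zero hz
  rw [G_eq hz p, norm_mul, norm_pow]
  field_simp

/-- A radius `0 < δ ≤ 1` such that the closed `δ`-discs around all the points `pt l n` miss the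
lattice (translate a disc around `l/2` by `n l ∈ Λ`). [folklore] -/
theorem exists_closedBall_pt_subset (hl : l ∈ L.lattice) (hl2 : l / 2 ∉ L.lattice) :
    ∃ δ : ℝ, 0 < δ ∧ δ ≤ 1 ∧ ∀ n : ℕ, closedBall (pt l n) δ ⊆ (L.lattice : Set ℂ)ᶜ := by
  have h := L.isClosed_lattice.isOpen_compl.mem_nhds hl2
  obtain ⟨ε, hε, hball⟩ := Metric.nhds_basis_closedBall.mem_iff.mp h
  refine ⟨min ε 1, by positivity, min_le_right _ _, fun n w hw hwΛ => ?_⟩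
  have hk : w - n * l ∈ closedBall (l / 2) ε := by
    rw [mem_closedBall_iff_norm] at hw ⊢
    refine le_trans (le_of_eq ?_) (hw.trans (min_le_left _ _))
    congr 1; unfold pt; ring
  exact hball hk (by simpa using sub_mem hwΛ (nat_mul_mem hl n))

/-- A positive lower bound for `|σ|` on the circles `|w - pt l n| = δ`, `n < m` (a compact set
missing the zero set `Λ` of `σ`). [folklore] -/
theorem exists_sigma_lower {δ : ℝ}
    (hball : ∀ n : ℕ, closedBall (pt l n) δ ⊆ (L.lattice : Set ℂ)ᶜ) (m : ℕ) :
    ∃ c : ℝ, 0 < c ∧ c ≤ 1 ∧ ∀ n < m, ∀ w ∈ sphere (pt l n) δ, c ≤ ‖L.weierstrassSigma w‖ := by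
  classical
  set K : Set ℂ := ⋃ n ∈ Finset.range m, sphere (pt l n) δ with hK
  have hKc : IsCompact K := (Finset.range m).isCompact_biUnion fun n _ => isCompact_sphere _ _
  have hKΛ : ∀ k ∈ K, k ∉ L.lattice := by
    intro k hk
    simp only [hK, Set.mem_iUnion, Finset.mem_range, exists_prop] at hk
    obtain ⟨n, -, hn⟩ := hk
    exact hball n (sphere_subset_closedBall hn)
  rcases K.eq_empty_or_nonempty with hKe | hne
  · refine ⟨1, one_pos, le_rfl, fun n hn w hw => ?_⟩
    have : w ∈ K := by
      simp only [hK, Set.mem_iUnion, Finset.mem_range, exists_prop]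
      exact ⟨n, hn, hw⟩
    rw [hKe] at this
    exact (Set.notMem_empty w this).elim
  have hcont : ContinuousOn (fun z => ‖L.weierstrassSigma z‖) K :=
    L.differentiable_weierstrassSigma_holds.continuous.norm.continuousOn
  obtain ⟨k₀, hk₀, hmin⟩ := hKc.exists_isMinOn hne hcont
  have hc0 : 0 < ‖L.weierstrassSigma k₀‖ :=
    norm_pos_iff.mpr (L.weierstrassSigma_ne_zero (hKΛ k₀ hk₀))
  refine ⟨min ‖L.weierstrassSigma k₀‖ 1, by positivity, min_le_right _ _, fun n hn w hw => ?_⟩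
  have hwK : w ∈ K := by
    simp only [hK, Set.mem_iUnion, Finset.mem_range, exists_prop]
    exact ⟨n, hn, hw⟩
  exact (min_le_left _ _).trans (isMinOn_iff.mp hmin w hwK)

variable (L) in
/-- **The fundamental upper bound** (Baker 1975, Ch. 6, §5: "`|φ^{(j)}(y_l)| ≤ j^{c₁₃ j - jm/(8ρ)}`").
There are constants `δ ∈ (0, 1]` and `C ≥ 0` (depending on the lattice, `l` and `m`) such that:
if `F_p^{(j)}(pt l n) = 0` for `j < S`, `n < m`, then for every `ν < m`, every `k`, every
`ρ ≥ ρ₀ m` and `R ≥ 2ρ`,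
`‖F_p^{(k)}(pt l ν)‖ ≤ ‖p‖ · k! · exp(C ((D+1)(1+R²) + k)) · (4ρ/R)^{S m}` — Schwarz's lemma for
`G_p`, division by `σ^{2D}` on the circle `|w - pt l ν| = δ`, Cauchy's inequality.
[cite: Baker1975, Ch. 6 §5 p. 59] -/
theorem norm_iteratedDeriv_F_le_of_zeros (hl : l ∈ L.lattice) (hl2 : l / 2 ∉ L.lattice) (m : ℕ) :
    ∃ C : ℝ, 0 ≤ C ∧ ∀ (D S : ℕ) (p : Fin (D + 1) × Fin (D + 1) → ℂ),
      (∀ n < m, ∀ j < S, iteratedDeriv j (F L D p) (pt l n) = 0) →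
      ∀ ν < m, ∀ (k : ℕ) (ρ : ℝ), ρ₀ l m ≤ ρ → ∀ R : ℝ, 2 * ρ ≤ R →
        ‖iteratedDeriv k (F L D p) (pt l ν)‖ ≤
          ‖p‖ * k.factorial * Real.exp (C * ((D + 1) * (1 + R ^ 2) + k)) * (4 * ρ / R) ^ (S * m) := by
  obtain ⟨δ, hδ, hδ1, hball⟩ := exists_closedBall_pt_subset hl hl2
  obtain ⟨c₀, hc₀, hc₀1, hlow⟩ := exists_sigma_lower hball m
  obtain ⟨CA, hCA, hA⟩ := norm_G_le_of_zeros L hl hl2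
  have hlog : 0 ≤ Real.log c₀⁻¹ := Real.log_nonneg (one_le_inv₀ hc₀ |>.mpr hc₀1)
  have hlogδ : 0 ≤ Real.log δ⁻¹ := Real.log_nonneg (one_le_inv₀ hδ |>.mpr hδ1)
  refine ⟨CA + 2 * Real.log c₀⁻¹ + Real.log δ⁻¹, by positivity,
    fun D S p hF ν hν k ρ hρ R hR => ?_⟩
  have hρ1 : 1 ≤ ρ := (one_le_ρ₀ m).trans hρ
  have hR1 : (1 : ℝ) ≤ 1 + R ^ 2 := by nlinarith
  -- the bound on the circle `|w - pt l ν| = δ`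
  set A : ℝ := ‖p‖ * Real.exp (CA * (D + 1) * (1 + R ^ 2)) * (4 * ρ / R) ^ (S * m) with hAdef
  have hA0 : 0 ≤ A := by
    have : 0 ≤ 4 * ρ / R := by
      apply div_nonneg (by linarith) (by linarith)
    positivity
  set B : ℝ := A * Real.exp (2 * Real.log c₀⁻¹ * D) with hBdef
  have hsphere : ∀ w ∈ sphere (pt l ν) δ, ‖F L D p w‖ ≤ B := by
    intro w hw
    have hwΛ : w ∉ L.lattice := hball ν (sphere_subset_closedBall hw)
    have hσ : c₀ ≤ ‖L.weierstrassSigma w‖ := hlow ν hν w hw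
    have hwn : ‖w‖ ≤ ρ := by
      have := norm_pt_add_le (l := l) hν (u := w - pt l ν)
        (by rw [mem_sphere_iff_norm] at hw; rw [hw]; exact hδ1)
      simpa using this.trans hρ
    have hG : ‖G L D p w‖ ≤ A := hA D S m p hF ρ hρ R hR w hwn
    rw [norm_F_eq hwΛ p, div_le_iff₀ (pow_pos (hc₀.trans_le hσ) _), hBdef]
    -- `A ≤ A e^{2D log c₀⁻¹} ‖σ w‖^{2D}` since `c₀^{2D} ≤ ‖σ w‖^{2D}` and `e^{-2D log c₀⁻¹} = c₀^{2D}`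
    have h1 : Real.exp (-(2 * Real.log c₀⁻¹ * D)) ≤ ‖L.weierstrassSigma w‖ ^ (2 * D) := by
      have : Real.exp (-(2 * Real.log c₀⁻¹ * D)) = c₀ ^ (2 * D) := by
        rw [show -(2 * Real.log c₀⁻¹ * D) = ((2 * D : ℕ) : ℝ) * Real.log c₀ by
          rw [Real.log_inv]; push_cast; ring, Real.exp_nat_mul, Real.exp_log hc₀]
      rw [this]
      exact pow_le_pow_left₀ hc₀.le hσ _
    calc ‖G L D p w‖ ≤ A := hG
      _ = A * Real.exp (2 * Real.log c₀⁻¹ * D) * Real.exp (-(2 * Real.log c₀⁻¹ * D)) := by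
          rw [mul_assoc, ← Real.exp_add, add_neg_cancel, Real.exp_zero, mul_one]
      _ ≤ A * Real.exp (2 * Real.log c₀⁻¹ * D) * ‖L.weierstrassSigma w‖ ^ (2 * D) := by
          gcongr
  -- Cauchy's inequality
  have hdiff : DiffContOnCl ℂ (F L D p) (ball (pt l ν) δ) := by
    refine DifferentiableOn.diffContOnCl fun w hw => ?_
    have hw' : w ∈ closedBall (pt l ν) δ := closure_ball_subset_closedBall hw
    exact (analyticAt_F p (hball ν hw')).differentiableAt.differentiableWithinAt
  have hC := Complex.norm_iteratedDeriv_le_of_forall_mem_sphere_norm_le k hδ hdiff hsphere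
  have hδk : (δ ^ k)⁻¹ ≤ Real.exp (Real.log δ⁻¹ * k) := by
    rw [mul_comm, Real.exp_nat_mul, Real.exp_log (inv_pos.mpr hδ), inv_pow]
  have h4 : 0 ≤ (4 * ρ / R) ^ (S * m) := pow_nonneg (div_nonneg (by linarith) (by linarith)) _
  calc ‖iteratedDeriv k (F L D p) (pt l ν)‖ ≤ k.factorial * B / δ ^ k := hC
    _ = k.factorial * B * (δ ^ k)⁻¹ := by rw [div_eq_mul_inv]
    _ ≤ k.factorial * B * Real.exp (Real.log δ⁻¹ * k) := by
        have : 0 ≤ (k.factorial : ℝ) * B := by rw [hBdef]; positivity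
        exact mul_le_mul_of_nonneg_left hδk this
    _ = ‖p‖ * k.factorial * Real.exp (CA * (D + 1) * (1 + R ^ 2) + 2 * Real.log c₀⁻¹ * D +
          Real.log δ⁻¹ * k) * (4 * ρ / R) ^ (S * m) := by
        rw [hBdef, hAdef, Real.exp_add, Real.exp_add]; ring
    _ ≤ ‖p‖ * k.factorial * Real.exp ((CA + 2 * Real.log c₀⁻¹ + Real.log δ⁻¹) *
          ((D + 1) * (1 + R ^ 2) + k)) * (4 * ρ / R) ^ (S * m) := by
        gcongr
        have h1 : (0 : ℝ) ≤ (D + 1) * (1 + R ^ 2) := by positivity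
        have h2 : (0 : ℝ) ≤ k := by positivity
        have hD : (D : ℝ) ≤ (D + 1) * (1 + R ^ 2) := by nlinarith
        nlinarith [mul_nonneg hlogδ h1, mul_nonneg hlog h2, mul_nonneg hCA h2,
          mul_le_mul_of_nonneg_left hD hlog]


/-! ### `z` and `℘(z)` are algebraically independent: `F_p ≢ 0` for `p ≠ 0` -/

/-- **Non-vanishing of the auxiliary function** (Baker 1975, Ch. 6, §5: "`Φ` vanishes
identically … implies that `f₁` and `f₂` are algebraically dependent"; here `f₁ = z`, `f₂ = ℘`
are algebraically independent). If `F_p(z) = 0` for all `z ∉ Λ` then `p = 0`: for `x ∈ ℂ` pick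
`z₀ ∉ Λ` with `℘(z₀) = x` (`PeriodPair.exists_weierstrassP_eq`); the polynomial
`∑ᵢ (∑ⱼ p(i,j) xʲ) Zⁱ` vanishes at the infinitely many points `z₀ + k l`, so `∑ⱼ p(i,j) xʲ = 0`
for every `x`, whence `p = 0`. [cite: Baker1975, Ch. 6 §5 p. 59] -/
theorem eq_zero_of_F_eq_zero (hl : l ∈ L.lattice) (hl0 : l ≠ 0)
    (p : Fin (D + 1) × Fin (D + 1) → ℂ) (h : ∀ z ∉ L.lattice, F L D p z = 0) : p = 0 := by
  classical
  -- Step 1: `∑ⱼ p(i,j) xʲ = 0` for all `x` and `i`.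
  have step1 : ∀ (x : ℂ) (i : Fin (D + 1)), ∑ j : Fin (D + 1), p (i, j) * x ^ (j : ℕ) = 0 := by
    intro x
    obtain ⟨z₀, hz₀, hx⟩ := L.exists_weierstrassP_eq x
    set c : Fin (D + 1) → ℂ := fun i => ∑ j : Fin (D + 1), p (i, j) * x ^ (j : ℕ) with hc
    set R : Polynomial ℂ := ∑ i : Fin (D + 1), Polynomial.monomial (i : ℕ) (c i) with hRdef
    have hR : ∀ k : ℕ, R.eval (z₀ + k * l) = 0 := by
      intro k
      have hz : z₀ + k * l ∉ L.lattice := add_notMem L hz₀ (nat_mul_mem hl k)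
      have hP : ℘[L] (z₀ + k * l) = x := by
        rw [← hx]
        simpa using L.weierstrassP_add_coe z₀ ⟨k * l, nat_mul_mem hl k⟩
      have h0 := h _ hz
      unfold F at h0
      simp only [hP] at h0
      rw [hRdef, Polynomial.eval_finsetSum]
      simp only [Polynomial.eval_monomial]
      rw [← h0, Fintype.sum_prod_type]
      refine Finset.sum_congr rfl fun i _ => ?_
      rw [hc]
      dsimp only
      rw [Finset.sum_mul]
      refine Finset.sum_congr rfl fun j _ => ?_
      ring
    have hR0 : R = 0 := by
      apply Polynomial.eq_zero_of_infinite_isRoot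
      have hinj : Function.Injective (fun k : ℕ => z₀ + k * l) := by
        intro a b hab
        have : (a : ℂ) * l = (b : ℂ) * l := by simpa using hab
        exact_mod_cast mul_right_cancel₀ hl0 this
      exact Set.infinite_of_injective_forall_mem hinj fun k => hR k
    intro i
    have hi := congrArg (fun q : Polynomial ℂ => q.coeff (i : ℕ)) hR0
    simp only [hRdef, coeff_sum_monomial_fin, dif_pos i.isLt, Fin.eta, Polynomial.coeff_zero] at hi
    exact hi
  -- Step 2: each `∑ⱼ p(i,j) Xʲ` has infinitely many roots.
  funext ij
  obtain ⟨i, j⟩ := ij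
  set Q : Polynomial ℂ := ∑ j : Fin (D + 1), Polynomial.monomial (j : ℕ) (p (i, j)) with hQdef
  have hQ : Q = 0 := by
    apply Polynomial.eq_zero_of_infinite_isRoot
    refine Set.infinite_univ.mono fun x _ => ?_
    change Q.eval x = 0
    rw [hQdef, Polynomial.eval_finsetSum]
    simp only [Polynomial.eval_monomial]
    exact step1 x i
  have hj := congrArg (fun q : Polynomial ℂ => q.coeff (j : ℕ)) hQ
  simp only [hQdef, coeff_sum_monomial_fin, dif_pos j.isLt, Fin.eta, Polynomial.coeff_zero] at hj
  exact hj

/-- For `p ≠ 0` the auxiliary function has FINITE order at every point `pt l n` (identity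
theorem on the connected open set `ℂ ∖ Λ`, then `eq_zero_of_F_eq_zero`). [folklore] -/
theorem analyticOrderAt_F_ne_top (hl : l ∈ L.lattice) (hl2 : l / 2 ∉ L.lattice)
    {p : Fin (D + 1) × Fin (D + 1) → ℂ} (hp : p ≠ 0) (n : ℕ) :
    analyticOrderAt (F L D p) (pt l n) ≠ ⊤ := by
  intro htop
  rw [analyticOrderAt_eq_top] at htop
  refine hp (eq_zero_of_F_eq_zero hl (ne_zero_of_half_notMem hl2) p fun z hz => ?_)
  exact (analyticOnNhd_F p).eqOn_zero_of_preconnected_of_eventuallyEq_zero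
    L.isPreconnected_compl_lattice (pt_notMem hl hl2 n) htop hz

end Literature.NumberTheory.Transcendental.Schneider1937

end
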